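import Mathlib
import Summits.Ventures.PercRepro.TriangleCapRowJ
import Summits.Ventures.PercRepro.TriangleCapMultiBroom

/-!
# PercRepro — THE STABILITY TABLE ON EVERY CELL `r ≥ a` WITH `r + 5 ≤ 2a`, IN ONE STATEMENT: the non-`a`-bipartite
second-best value of the `K₄⁻`-free cherry table on `(k, a, r)`, `a ≤ 18`, `2a + r ≤ k`, is EXACTLY
`closed − (2 (k − a − 3) + 2 (r − a)(a − 2))`, attained by the `(r − a + 1)`-broom; and the second-best value of the
cherry table itself is `closed − 2 (r − 2)` on every such cell (p3, gen 48; part 202i)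

`rowJ_nonbip_second_best` = part 202g (the bound) + part 202h (the witness); `stab_table_gen` / `cherry_second_best_gen`
restate it in the cell coordinates `(k, a, r)`, `r = a + j`: `2a + r ≤ k` is `3a + j ≤ k`, `r + 5 ≤ 2a` is `j + 5 ≤ a`.
With parts 200j–200v and 201d (the cells `r ≤ a + 2`, `5 ≤ a ≤ 18`) the stability table is a theorem on every cell
`r ≤ 2a − 5` of every row `5 ≤ a ≤ 18` (and on `r ≤ a + 2` for `a ∈ {5, 6}`). Axioms: standard.
-/

namespace PercRepro

namespace TriangleCap

namespace C047

open Finset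

/-- **THE NON-BIPARTITE SECOND-BEST VALUE ON THE CELL `(k, a, a + j)`, `j + 5 ≤ a ≤ 18`, `3a + j ≤ k`:** EXACTLY
`m k − (a + j)(k − 1 − (a + j)) − (2 (k − a − 3) + 2j (a − 2))`, attained by the `(j + 1)`-broom. -/
theorem rowJ_nonbip_second_best (k a j : ℕ) (ha : j + 5 ≤ a) (ha18 : a ≤ 18) (hk : 3 * a + j ≤ k) :
    (∀ (D : SimpleGraph (Fin k)) [DecidableRel D.Adj], K4mFree D → D.edgeFinset.card + (a + j) = a * (k - a) →
        (¬ ∃ A : Finset (Fin k), A.card = a ∧ BipSub D A) →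
        ∑ v, deg D v * deg D v + (a + j) * (k - 1 - (a + j)) + (2 * (k - a - 3) + 2 * j * (a - 2)) ≤
          D.edgeFinset.card * k) ∧
      ∃ (D : SimpleGraph (Fin k)) (_ : DecidableRel D.Adj), K4mFree D ∧ D.edgeFinset.card + (a + j) = a * (k - a) ∧
        (¬ ∃ A : Finset (Fin k), A.card = a ∧ BipSub D A) ∧
        ∑ v, deg D v * deg D v + (a + j) * (k - 1 - (a + j)) + (2 * (k - a - 3) + 2 * j * (a - 2)) =
          D.edgeFinset.card * k := by
  have hcard : Fintype.card (Fin k) = k := Fintype.card_fin k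
  refine ⟨?_, ?_⟩
  · intro D _ hK hm hnb
    rcases rowJ_second_order D hK a j ha ha18 (by rw [hcard]; exact hk) (by rw [hcard]; exact hm) with h | h
    · exact absurd h hnb
    · rw [hcard] at h
      exact h
  · obtain ⟨hK, hE, hnb, hS⟩ := multiBroom_value k a j (by omega) (by omega) (by omega)
    exact ⟨_, inferInstance, hK, hE, hnb, hS⟩

/-- **THE NON-BIPARTITE STABILITY TABLE ON EVERY CELL `a ≤ r ≤ 2a − 5` OF EVERY ROW `a ≤ 18`**, `2a + r ≤ k`: every
non-`a`-bipartite `K₄⁻`-free graph on `Fin k` with `a (k − a) − r` edges has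
`Σ_v d(v)² + r (k − 1 − r) + (2 (k − a − 3) + 2 (r − a)(a − 2)) ≤ m k`, and the value is attained. -/
theorem stab_table_gen (k a r : ℕ) (ha18 : a ≤ 18) (har : a ≤ r) (hr : r + 5 ≤ 2 * a) (hk : 2 * a + r ≤ k) :
    (∀ (D : SimpleGraph (Fin k)) [DecidableRel D.Adj], K4mFree D → D.edgeFinset.card + r = a * (k - a) →
        (¬ ∃ A : Finset (Fin k), A.card = a ∧ BipSub D A) →
        ∑ v, deg D v * deg D v + r * (k - 1 - r) + (2 * (k - a - 3) + 2 * (r - a) * (a - 2)) ≤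
          D.edgeFinset.card * k) ∧
      ∃ (D : SimpleGraph (Fin k)) (_ : DecidableRel D.Adj), K4mFree D ∧ D.edgeFinset.card + r = a * (k - a) ∧
        (¬ ∃ A : Finset (Fin k), A.card = a ∧ BipSub D A) ∧
        ∑ v, deg D v * deg D v + r * (k - 1 - r) + (2 * (k - a - 3) + 2 * (r - a) * (a - 2)) =
          D.edgeFinset.card * k := by
  obtain ⟨j, rfl⟩ : ∃ j, r = a + j := ⟨r - a, by omega⟩
  have e : a + j - a = j := by omega
  rw [e]
  exact rowJ_nonbip_second_best k a j (by omega) ha18 (by omega)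

/-- **THE SECOND-BEST VALUE OF THE CHERRY TABLE ON EVERY CELL `a ≤ r ≤ 2a − 5`**, `a ≤ 18`, `2a + r ≤ k`:
`closed − 2 (r − 2)` (the brooms of the `a`-side). -/
theorem cherry_second_best_gen (k a r : ℕ) (ha18 : a ≤ 18) (har : a ≤ r) (hr : r + 5 ≤ 2 * a)
    (hk : 2 * a + r ≤ k) :
    (∀ (D : SimpleGraph (Fin k)) [DecidableRel D.Adj], K4mFree D → D.edgeFinset.card + r = a * (k - a) →
        ∑ v, deg D v * deg D v + r * (k - 1 - r) ≠ D.edgeFinset.card * k →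
        ∑ v, deg D v * deg D v + r * (k - 1 - r) + 2 * (r - 2) ≤ D.edgeFinset.card * k) ∧
      ∃ (D : SimpleGraph (Fin k)) (_ : DecidableRel D.Adj), K4mFree D ∧ D.edgeFinset.card + r = a * (k - a) ∧
        ∑ v, deg D v * deg D v + r * (k - 1 - r) + 2 * (r - 2) = D.edgeFinset.card * k := by
  have hcard : Fintype.card (Fin k) = k := Fintype.card_fin k
  refine ⟨?_, ?_⟩
  · intro D _ hK hm hne
    by_cases hnb : ∃ A : Finset (Fin k), A.card = a ∧ BipSub D A
    · obtain ⟨A, hAcard, hB⟩ := hnb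
      by_cases hstar : ∃ v, MissingStar D A v
      · obtain ⟨v, hv⟩ := hstar
        have h := closed_form_eq_of_missingStar D A hB hv a r hAcard (by rw [hcard]; exact hm)
          (by rw [hcard]; omega)
        rw [hcard] at h
        exact absurd h hne
      · have h := closed_form_stability_bipSub D A hB a r hAcard (by rw [hcard]; exact hm) (by rw [hcard]; omega)
          (by omega) hstar
        rw [hcard] at h
        exact h
    · have h := (stab_table_gen k a r ha18 har hr hk).1 D hK hm hnb
      have hge : 2 * (r - 2) ≤ 2 * (k - a - 3) + 2 * (r - a) * (a - 2) := by
        obtain ⟨j, rfl⟩ : ∃ j, r = a + j := ⟨r - a, by omega⟩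
        have e1 : a + j - a = j := by omega
        rw [e1]
        obtain ⟨a', rfl⟩ : ∃ a', a = a' + 5 := ⟨a - 5, by omega⟩
        have e2 : a' + 5 + j - 2 = a' + 3 + j := by omega
        have e3 : a' + 5 - 2 = a' + 3 := by omega
        rw [e2, e3]
        have hk' : 3 * (a' + 5) + j ≤ k := by omega
        have e4 : k - (a' + 5) - 3 = k - (a' + 8) := by omega
        rw [e4]
        obtain ⟨c, rfl⟩ : ∃ c, k = a' + 8 + c := ⟨k - (a' + 8), by omega⟩
        rw [Nat.add_sub_cancel_left]
        nlinarith [Nat.zero_le (j * a')]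
      omega
  · obtain ⟨D, inst, A, hK, hAcard, hB, hns, hE, hS⟩ := broom_value k a r (by omega) (by omega) (by omega)
    have hr' : r ≤ a * (k - a) := by
      have h1 : 2 ≤ k - a := by omega
      have h2 : a * 2 ≤ a * (k - a) := Nat.mul_le_mul_left a h1
      omega
    have hE' : D.edgeFinset.card + r = a * (k - a) := by rw [hE]; omega
    refine ⟨D, inst, hK, hE', ?_⟩
    rw [hE]
    exact hS

end C047

end TriangleCap

end PercRepro
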